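import Literature.MathematicalPhysics.QuantumManyBody.GroundStateFeynmanKacMarkov
import Mathlib.Probability.Independence.Basic
import Mathlib.MeasureTheory.Constructions.BorelSpace.Metrizable
import HarnessLib

/-!
# Route BECCutLineWeakDisorder — `WitnessTransfer`: Blumenthal's zero-one law for the `3N`
# Brownian coordinates

Support file (does not close the item) for item stmt-AtomisticToContinuum-14978
(`Summit.AtomisticToContinuum.BoseEinsteinCondensation.Theses.BECCutLineWeakDisorder`, decl
`WitnessTransfer`), stub (S4) `stub_wienerPaths_zero_or_one_of_germ` of line `Sketch`.

For the `3N` independent canonical Brownian coordinates `ω i k` of `PathSpace N` under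
`wienerPaths N`, an event `E` which for every `s > 0` coincides a.s. with an event of the raw past
`𝓕_s = σ(b_u(ω i k) : u ≤ s, i, k)` has probability `0` or `1`. This is the many-coordinate
transplant of the tree's one-dimensional
`ProbabilityTheory.IsPreBrownianReal.measure_zero_or_one_of_germ`
(`Literature/Probability/Process/BlumenthalZeroOne.lean`): the role of Mathlib's
`IsPreBrownianReal.indepFun_shift` is played by the multi-dimensional weak Markov property
`indepFun_pathsShift_pathsPast` (`GroundStateFeynmanKacMarkov.lean`).

Proof (Revuz–Yor, Ch. III, Thm. (2.15); Mörters–Peres, Thm. 2.7): the family of increments after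
time `tₙ = 1/(n+1)`, `Gₙ = σ(b(tₙ + u)(ω i k) - b(tₙ)(ω i k) : u ≥ 0, i, k)`, is independent of
`𝓕_{tₙ}`, hence of `E`; the `Gₙ` increase and form a π-system generating `G = ⨆ₙ Gₙ`; by
continuity of the paths and `b 0 = 0`, every coordinate `b_u(ω i k) = limₙ (b(tₙ + u) - b(tₙ))`
is `G`-measurable, so `𝓕_s ≤ G` for every `s` and a version of `E` is `G`-measurable; so `E` is
independent of itself (π-λ, Mathlib `IndepSets.indep`) and `P E = (P E)²`.

## References

* D. Revuz, M. Yor, *Continuous Martingales and Brownian Motion*, 3rd ed., Springer (1999),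
  Ch. III, Thm. (2.15) (Blumenthal's zero-one law). [RevuzYor1999]
* P. Mörters, Y. Peres, *Brownian Motion*, Cambridge Univ. Press (2010), Thm. 2.7.
* R. M. Blumenthal, *An extended Markov property*, Trans. Amer. Math. Soc. 85 (1957) 52–72.
-/

noncomputable section

open MeasureTheory ProbabilityTheory Filter Set Metric
open scoped ENNReal NNReal Topology

namespace Summit.AtomisticToContinuum.BoseEinsteinCondensation.Theorems.CutLineWitness

open Literature.MathematicalPhysics.QuantumManyBody.BoseGas
open Literature.Probability.Process

/-! ### (S4) Blumenthal's zero-one law for the `3N` Brownian coordinates -/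

/-- **(S4)** An event of `PathSpace N` which for every `s > 0` coincides a.s. with an event of the
past `σ(b_u(ω i k) : u ≤ s, i, k)` has probability `0` or `1` under `wienerPaths N` (weak Markov
property `indepFun_pathsShift_pathsPast`, path continuity and `b₀ = 0`, π–λ).
[cite: RevuzYor1999, Ch. III Thm. (2.15)] -/
theorem stub_wienerPaths_zero_or_one_of_germ {N : ℕ} {E : Set (PathSpace N)}
    (hE : ∀ s : ℝ≥0, 0 < s → ∃ E' : Set (PathSpace N),
      MeasurableSet[MeasurableSpace.comap (fun (ω : PathSpace N) (i : Fin N) (k : Fin 3)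
        (u : Set.Iic s) => brownian u (ω i k)) inferInstance] E' ∧ E =ᵐ[wienerPaths N] E') :
    wienerPaths N E = 0 ∨ wienerPaths N E = 1 := by
  -- the times `t n = 1/(n+1) ↓ 0`
  set t : ℕ → ℝ≥0 := fun n => 1 / ((n : ℝ≥0) + 1) with ht
  have ht_pos : ∀ n, 0 < t n := fun n => by rw [ht]; positivity
  have ht_anti : Antitone t := by
    intro m n hmn
    simp only [ht]
    exact one_div_le_one_div_of_le (by positivity) (by exact_mod_cast Nat.add_le_add_right hmn 1)
  have ht_lim : Tendsto t atTop (𝓝 0) := by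
    rw [← NNReal.tendsto_coe]
    have h : (fun n => ((t n : ℝ≥0) : ℝ)) = fun n : ℕ => 1 / ((n : ℝ) + 1) := by
      funext n; simp [ht]
    rw [h, NNReal.coe_zero]
    exact tendsto_one_div_add_atTop_nhds_zero_nat
  -- evaluation of a family of paths at `(i, k, v)` is measurable
  have hev : ∀ (i : Fin N) (k : Fin 3) (v : ℝ≥0),
      Measurable fun f : (Fin N → Fin 3 → ℝ≥0 → ℝ) => f i k v := fun i k v =>
    measurable_pi_iff.1 (measurable_pi_iff.1 (measurable_pi_apply i) k) v
  -- the families of increment processes after `t n` and the σ-algebras they generate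
  set sh : ℕ → PathSpace N → (Fin N → Fin 3 → ℝ≥0 → ℝ) := fun n ω i k u =>
    brownian (t n + u) (ω i k) - brownian (t n) (ω i k) with hsh
  have hsh_meas : ∀ n, Measurable (sh n) := fun n => measurable_pathsShift N (t n)
  set G : ℕ → MeasurableSpace (PathSpace N) := fun n =>
    MeasurableSpace.comap (sh n) inferInstance with hG
  have hGle : ∀ n, G n ≤ (inferInstance : MeasurableSpace (PathSpace N)) := fun n =>
    (hsh_meas n).comap_le
  have hGmono : Monotone G := by
    intro m n hmn
    have hle : t n ≤ t m := ht_anti hmn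
    -- `sh m` factors through `sh n`
    set d : ℝ≥0 := t m - t n with hd
    set Φ : (Fin N → Fin 3 → ℝ≥0 → ℝ) → (Fin N → Fin 3 → ℝ≥0 → ℝ) := fun f i k u =>
      f i k (d + u) - f i k d with hΦ
    have hΦm : Measurable Φ := by
      refine measurable_pi_lambda _ fun i => measurable_pi_lambda _ fun k =>
        measurable_pi_lambda _ fun u => ?_
      exact (hev i k (d + u)).sub (hev i k d)
    have hcomp : sh m = Φ ∘ sh n := by
      funext ω i k u
      simp only [hΦ, hsh, Function.comp_apply]
      have h1 : t n + (d + u) = t m + u := by rw [← add_assoc, hd, add_tsub_cancel_of_le hle]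
      have h2 : t n + d = t m := by rw [hd, add_tsub_cancel_of_le hle]
      rw [h1, h2]
      ring
    change MeasurableSpace.comap (sh m) inferInstance ≤ MeasurableSpace.comap (sh n) inferInstance
    rw [hcomp, ← MeasurableSpace.comap_comp]
    exact MeasurableSpace.comap_mono hΦm.comap_le
  -- the past σ-algebras and the weak Markov property at `t n`
  set F : ℝ≥0 → MeasurableSpace (PathSpace N) := fun s =>
    MeasurableSpace.comap (fun (ω : PathSpace N) (i : Fin N) (k : Fin 3) (u : Set.Iic s) =>
      brownian u (ω i k)) inferInstance with hF
  have hind : ∀ n, Indep (G n) (F (t n)) (wienerPaths N) := fun n =>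
    (IndepFun_iff_Indep _ _ _).1 (indepFun_pathsShift_pathsPast N (t n))
  -- `E` is independent of every `G n`-event
  have hprod : ∀ n (C : Set (PathSpace N)), MeasurableSet[G n] C →
      wienerPaths N (E ∩ C) = wienerPaths N E * wienerPaths N C := by
    intro n C hC
    obtain ⟨E', hE'meas, hEE'⟩ := hE (t n) (ht_pos n)
    have h1 : wienerPaths N (E ∩ C) = wienerPaths N (C ∩ E') := by
      rw [Set.inter_comm E C]
      exact measure_congr (EventuallyEq.rfl.inter hEE')
    rw [h1, (Indep_iff _ _ _).1 (hind n) _ _ hC hE'meas, measure_congr hEE', mul_comm]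
  -- the π-system `⋃ n, G n` generates `⨆ n, G n`
  set p : Set (Set (PathSpace N)) := ⋃ n, {C | MeasurableSet[G n] C} with hp
  have hp_pi : IsPiSystem p :=
    isPiSystem_iUnion_of_monotone (fun n => {C | MeasurableSet[G n] C})
      (fun n => @MeasurableSpace.isPiSystem_measurableSet (PathSpace N) (G n))
      (fun m n hmn C hC => hGmono hmn C hC)
  have hp_gen : MeasurableSpace.generateFrom p = ⨆ n, G n :=
    MeasurableSpace.generateFrom_iUnion_measurableSet G
  -- every coordinate `b_u(ω i k) = limₙ sh n ω i k u` is `⨆ n, G n`-measurable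
  -- (continuity of the paths, `b 0 = 0`)
  have hcoord : ∀ (i : Fin N) (k : Fin 3) (u : ℝ≥0),
      Measurable[⨆ n, G n] fun ω : PathSpace N => brownian u (ω i k) := by
    intro i k u
    have hf : ∀ n, Measurable[⨆ l, G l] fun ω => sh n ω i k u := fun n => by
      have h1 : Measurable[G n] fun ω => sh n ω i k u :=
        (hev i k u).comp (comap_measurable (sh n))
      exact h1.mono (le_iSup G n) le_rfl
    refine @measurable_of_tendsto_metrizable (PathSpace N) ℝ (⨆ l, G l) _ _ _ _
      (fun n ω => sh n ω i k u) (fun ω => brownian u (ω i k)) hf ?_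
    rw [tendsto_pi_nhds]
    intro ω
    have hc := continuous_brownian (ω i k)
    have h1 : Tendsto (fun n => brownian (t n + u) (ω i k)) atTop (𝓝 (brownian (0 + u) (ω i k))) :=
      (hc.tendsto (0 + u)).comp (ht_lim.add tendsto_const_nhds)
    have h2 : Tendsto (fun n => brownian (t n) (ω i k)) atTop (𝓝 (brownian 0 (ω i k))) :=
      (hc.tendsto 0).comp ht_lim
    have h3 := h1.sub h2
    rw [zero_add, brownian_zero, Pi.zero_apply, sub_zero] at h3
    exact h3
  have hFle : ∀ s, F s ≤ ⨆ n, G n := by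
    intro s
    have h : Measurable[⨆ n, G n]
        (fun (ω : PathSpace N) (i : Fin N) (k : Fin 3) (u : Set.Iic s) => brownian u (ω i k)) := by
      refine @measurable_pi_lambda (PathSpace N) (Fin N) (fun _ => Fin 3 → Set.Iic s → ℝ)
        (⨆ n, G n) _ _ fun i => ?_
      refine @measurable_pi_lambda (PathSpace N) (Fin 3) (fun _ => Set.Iic s → ℝ)
        (⨆ n, G n) _ _ fun k => ?_
      exact @measurable_pi_lambda (PathSpace N) (Set.Iic s) (fun _ => ℝ) (⨆ n, G n) _ _
        fun j => hcoord i k j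
    exact h.comap_le
  -- a version `E'` of `E` measurable with respect to `⨆ n, G n`
  obtain ⟨E', hE'F, hEE'⟩ := hE (t 0) (ht_pos 0)
  have hE'tail : MeasurableSet[⨆ n, G n] E' := hFle _ _ hE'F
  have hE'meas : MeasurableSet E' := (iSup_le hGle) _ hE'tail
  -- independence of `σ(E')` and `⨆ n, G n`
  have hindep : Indep (MeasurableSpace.generateFrom {E'}) (⨆ n, G n) (wienerPaths N) := by
    refine IndepSets.indep (MeasurableSpace.generateFrom_le (by simpa using hE'meas))
      (iSup_le hGle) (IsPiSystem.singleton E') hp_pi rfl hp_gen.symm ?_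
    rw [IndepSets_iff]
    rintro s C hs ⟨_, ⟨n, rfl⟩, hC⟩
    rw [mem_singleton_iff] at hs
    subst hs
    rw [measure_congr (hEE'.symm.inter EventuallyEq.rfl), hprod n C hC, measure_congr hEE']
  have hsq : wienerPaths N E' = wienerPaths N E' * wienerPaths N E' := by
    have := (Indep_iff _ _ _).1 hindep E' E' (MeasurableSpace.measurableSet_generateFrom rfl)
      hE'tail
    rwa [inter_self] at this
  rw [measure_congr hEE']
  by_cases hzero : wienerPaths N E' = 0
  · exact Or.inl hzero
  · exact Or.inr ((ENNReal.mul_eq_left hzero (measure_ne_top (wienerPaths N) E')).1 hsq.symm)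

end Summit.AtomisticToContinuum.BoseEinsteinCondensation.Theorems.CutLineWitness

end
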